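import Summits.CriticalPhenomena.PercolationContinuityZ3.Theses.PercTreeValue
import Literature.Probability.Percolation.ConnectivityThetaSqProofs
import Literature.Probability.Percolation.LocalEvents
import Literature.Probability.Percolation.BondPercolationBlockIndependence
import HarnessLib

/-!
# `PercTreeValue.ConnectionPatternFactorisation` (stmt-CriticalPhenomena-7802): proof

Route `PercTreeValue`, support item `ConnectionPatternFactorisation` ("jump ⟹ pattern-blindness"):
for nearest-neighbour Bernoulli bond percolation on `ℤ³`, every `p ∈ [0, 1]`, every `k`, every
loopless pattern `E ⊆ Fin k × Fin k` mentioning every index and every sequence of `k`-point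
configurations `A n : Fin k → ℤ³` whose pairwise sup-distances tend to infinity,
`P_p(⋂_{(i,j) ∈ E} {A n i ↔ A n j}) → θ(p)^k`.

## The argument (Grimmett 1999, §8.5 p. 213 for `k = 2`; folklore in general)

Write `μ = P_p`, `θ = θ(p) = μ(|C(0)| = ∞)`.

* **`k`-fold mixing** (`tendsto_real_iInter_percolatesAt`): `μ(⋂_i {|C(x_i)| = ∞}) → θ^k` as the
  pairwise distances of `x_1, …, x_k` tend to infinity. Approximate `{|C(0)| = ∞}` in measure by a
  local event `L` determined by a finite edge set `F` (`exists_isLocalEvent_measure_symmDiff_lt`);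
  its translates `L + x_i` are determined by the translates `F + x_i`, pairwise disjoint once the
  points are `> 2R` apart (`R` a radius of `F`), hence mutually independent under the product
  measure (`bondPercolation_iIndep_edgeSigma`): `μ(⋂_i (L + x_i)) = μ(L)^k`; translation
  invariance (`bondPercolation_real_preimage_shift`) controls both replacement errors by
  `k · μ(L ∆ {|C(0)| = ∞})`.
* **lower bound**: on the almost sure event "at most one infinite cluster"
  (`Grimmett1999_numInfiniteClusters_le_one_holds`), `⋂_i {|C(A n i)| = ∞}` forces every prescribed
  connection (`mem_openConn_of_numInfiniteClusters_le_one`).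
* **upper bound**: if the prescribed connections hold but some `A n i` has a finite cluster, pick
  `e ∈ E` mentioning `i`; then `{A n e.1 ↔ A n e.2, |C(A n e.1)| < ∞}` occurs, an event of
  probability `μ(0 ↔ y - x, |C(0)| < ∞) ≤ μ(|C(0)| < ∞, C(0) reaches distance ≥ m) → 0`
  (`m → ∞`, continuity from above: a finite cluster is bounded).

Inputs (tree): `UniquenessInfiniteCluster.lean`, `LocalEvents.lean`, `BondPercolationBlockIndependence.lean`
/ `FiniteEnergy.lean` (independence of disjoint edge sets), `BondPercolationSymmetry.lean` (translations).
-/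

noncomputable section

namespace Summit.CriticalPhenomena.PercolationContinuityZ3.Theorems

open MeasureTheory ProbabilityTheory Filter Topology
open Literature.Probability.Percolation Literature.Probability.LatticeModels
open scoped symmDiff

variable {d : ℕ}

/-! ### Set-theoretic and numerical helpers -/

/-- The symmetric difference of two finite intersections is covered by the union of the
symmetric differences of the factors. -/
private theorem iInter_symmDiff_iInter_subset {α ι : Type*} (s t : ι → Set α) :
    (⋂ i, s i) ∆ (⋂ i, t i) ⊆ ⋃ i, s i ∆ t i := by
  intro ω hω
  rw [Set.mem_symmDiff] at hω
  simp only [Set.mem_iUnion, Set.mem_symmDiff]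
  rcases hω with ⟨hs, ht⟩ | ⟨ht, hs⟩
  · rw [Set.mem_iInter] at hs ht
    push Not at ht
    obtain ⟨i, hi⟩ := ht
    exact ⟨i, Or.inl ⟨hs i, hi⟩⟩
  · rw [Set.mem_iInter] at hs ht
    push Not at hs
    obtain ⟨i, hi⟩ := hs
    exact ⟨i, Or.inr ⟨ht i, hi⟩⟩

/-- `|a^k - b^k| ≤ k |a - b|` for `a, b ∈ [0, 1]`. -/
private theorem abs_pow_sub_pow_le_unit {a b : ℝ} (ha0 : 0 ≤ a) (ha1 : a ≤ 1) (hb0 : 0 ≤ b)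
    (hb1 : b ≤ 1) (k : ℕ) : |a ^ k - b ^ k| ≤ k * |a - b| := by
  have h := abs_pow_sub_pow_le a b k
  have hmax : max |a| |b| ≤ 1 :=
    max_le (by rwa [abs_of_nonneg ha0]) (by rwa [abs_of_nonneg hb0])
  have hmax0 : 0 ≤ max |a| |b| := le_max_of_le_left (abs_nonneg a)
  have hpow : max |a| |b| ^ (k - 1) ≤ 1 := pow_le_one₀ hmax0 hmax
  calc |a ^ k - b ^ k| ≤ |a - b| * k * max |a| |b| ^ (k - 1) := h
    _ ≤ |a - b| * k * 1 := mul_le_mul_of_nonneg_left hpow (by positivity)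
    _ = k * |a - b| := by ring

/-- Within one open cluster: if `x ↔ y` and `|C(x)| = ∞` then `|C(y)| = ∞` (the clusters
coincide). -/
private theorem mem_percolatesAt_of_openConn {V : Type*} {ω : BondConfig V} {x y : V}
    (hxy : ω ∈ openConn x y) (hx : ω ∈ percolatesAt x) : ω ∈ percolatesAt y := by
  have hC : openCluster ω y = openCluster ω x := by
    ext z
    exact ⟨fun hz => SimpleGraph.Reachable.trans hxy hz,
      fun hz => SimpleGraph.Reachable.trans (SimpleGraph.Reachable.symm hxy) hz⟩
  change (openCluster ω y).Infinite
  rw [hC]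
  exact hx

/-! ### Lattice translations of configurations

We translate configurations by `-x`, `ω ↦ ω - x` (`BondConfig.relabel (sym2Equiv (Site.shift (-x)))`),
so that events "at `x`" are the preimages of the corresponding events "at `0`". -/

/-- `{|C(x)| = ∞}` is the preimage of `{|C(0)| = ∞}` under `ω ↦ ω - x`. -/
private theorem preimage_shift_percolatesAt_zero (x : Site d) :
    BondConfig.relabel (sym2Equiv (Site.shift (-x))) ⁻¹'
        (percolatesAt (0 : Site d) : Set (BondConfig (Site d))) = percolatesAt x := by
  have h := preimage_relabel_shift_percolatesAt (-x) x
  rwa [add_neg_cancel] at h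

/-- `{x ↔ y}` is the preimage of `{0 ↔ y - x}` under `ω ↦ ω - x`. -/
private theorem preimage_shift_openConn_zero (x y : Site d) :
    BondConfig.relabel (sym2Equiv (Site.shift (-x))) ⁻¹'
        (openConn (0 : Site d) (y - x) : Set (BondConfig (Site d))) = openConn x y := by
  have h := preimage_relabel_shift_openConn (-x) x y
  rwa [add_neg_cancel, ← sub_eq_add_neg] at h

/-- Pulling back an event determined by the edge set `F` along a relabelling `e` of edges gives an
event determined by `e ⁻¹' F`. -/
private theorem determinedBy_preimage_relabel_sym2 {V : Type*} (e : Sym2 V ≃ Sym2 V)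
    {A : Set (BondConfig V)} {F : Set (Sym2 V)} (hA : DeterminedBy A F) :
    DeterminedBy (BondConfig.relabel e ⁻¹' A) (e ⁻¹' F) := by
  rw [determinedBy_iff] at hA ⊢
  intro ω ω' h
  simp only [Set.mem_preimage]
  apply hA
  ext z
  simp only [Set.mem_inter_iff, BondConfig.relabel_apply, Set.mem_image]
  constructor
  · rintro ⟨⟨y, hy, rfl⟩, hz⟩
    have : y ∈ ω' ∩ e ⁻¹' F := by rw [← h]; exact ⟨hy, hz⟩
    exact ⟨⟨y, this.1, rfl⟩, hz⟩
  · rintro ⟨⟨y, hy, rfl⟩, hz⟩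
    have : y ∈ ω ∩ e ⁻¹' F := by rw [h]; exact ⟨hy, hz⟩
    exact ⟨⟨y, this.1, rfl⟩, hz⟩

/-- **Radius of a finite edge set.** For a finite set `F` of pairs of sites there is `R` such that
the translates `F + x`, `F + x'` (preimages of `F` under the edge maps of `· - x`, `· - x'`) are
disjoint whenever `‖x - x'‖ > 2R`. -/
private theorem exists_radius (F : Finset (Sym2 (Site d))) :
    ∃ R : ℝ, ∀ x x' : Site d, 2 * R < ‖x - x'‖ →
      Disjoint ((sym2Equiv (Site.shift (-x))) ⁻¹' (↑F : Set (Sym2 (Site d))))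
        ((sym2Equiv (Site.shift (-x'))) ⁻¹' (↑F : Set (Sym2 (Site d)))) := by
  classical
  let g : Sym2 (Site d) → ℝ := Sym2.lift ⟨fun a b => max ‖a‖ ‖b‖, fun a b => max_comm _ _⟩
  have hg : ∀ a b : Site d, g s(a, b) = max ‖a‖ ‖b‖ := fun a b => rfl
  have hg0 : ∀ z, 0 ≤ g z := by
    intro z
    induction z using Sym2.ind with
    | h a b => rw [hg]; exact le_max_of_le_left (norm_nonneg a)
  refine ⟨∑ z ∈ F, g z, fun x x' hxx' => ?_⟩
  have hle : ∀ z ∈ F, ∀ a b : Site d, z = s(a, b) → ‖a‖ ≤ ∑ z ∈ F, g z := by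
    intro z hz a b hzab
    calc ‖a‖ ≤ max ‖a‖ ‖b‖ := le_max_left _ _
      _ = g z := by rw [hzab, hg]
      _ ≤ ∑ z ∈ F, g z := Finset.single_le_sum (fun z _ => hg0 z) hz
  rw [Set.disjoint_left]
  intro z hz hz'
  rw [Set.mem_preimage, Finset.mem_coe] at hz hz'
  induction z using Sym2.ind with
  | h a b =>
    rw [sym2Equiv_mk] at hz hz'
    simp only [Site.shift_apply] at hz hz'
    have h1 : ‖a + -x‖ ≤ ∑ z ∈ F, g z := hle _ hz _ _ rfl
    have h2 : ‖a + -x'‖ ≤ ∑ z ∈ F, g z := hle _ hz' _ _ rfl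
    have h3 : ‖x - x'‖ ≤ 2 * ∑ z ∈ F, g z := by
      calc ‖x - x'‖ = ‖(a + -x') - (a + -x)‖ := by congr 1; abel
        _ ≤ ‖a + -x'‖ + ‖a + -x‖ := norm_sub_le _ _
        _ ≤ (∑ z ∈ F, g z) + ∑ z ∈ F, g z := add_le_add h2 h1
        _ = 2 * ∑ z ∈ F, g z := by ring
    exact absurd hxx' (not_lt.2 h3)

/-! ### Finite clusters do not reach far: `P_p(x ↔ y, |C(x)| < ∞) → 0` as `‖x - y‖ → ∞` -/

/-- The events `{|C(0)| < ∞} ∩ {0 ↔ z for some ‖z‖ ≥ m}` decrease to `∅` (a finite cluster is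
bounded), so their probabilities tend to `0` (continuity from above). -/
private theorem tendsto_real_finiteCluster_reaches (p : unitInterval) :
    Tendsto (fun m : ℕ => (bondPercolation (zdGraph d) p).real
      ((percolatesAt (0 : Site d))ᶜ ∩ ⋃ z ∈ {z : Site d | (m : ℝ) ≤ ‖z‖}, openConn 0 z))
      atTop (𝓝 0) := by
  set μ := bondPercolation (zdGraph d) p with hμ
  set G : ℕ → Set (BondConfig (Site d)) := fun m =>
    (percolatesAt (0 : Site d))ᶜ ∩ ⋃ z ∈ {z : Site d | (m : ℝ) ≤ ‖z‖}, openConn 0 z with hG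
  have hGm : ∀ m, MeasurableSet (G m) := fun m =>
    (measurableSet_percolatesAt_holds (0 : Site d)).compl.inter
      (MeasurableSet.biUnion (Set.to_countable _) fun z _ => measurableSet_openConn_holds 0 z)
  have hanti : Antitone G := by
    intro m m' hmm' ω hω
    refine ⟨hω.1, ?_⟩
    obtain ⟨z, hz, hωz⟩ := Set.mem_iUnion₂.1 hω.2
    have hz' : (m' : ℝ) ≤ ‖z‖ := hz
    exact Set.mem_iUnion₂.2 ⟨z, le_trans (Nat.cast_le.2 hmm') hz', hωz⟩
  have hempty : ⋂ m, G m = ∅ := by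
    ext ω
    simp only [Set.mem_iInter, Set.mem_empty_iff_false, iff_false]
    intro h
    have hfin : (openCluster ω (0 : Site d)).Finite := Set.not_infinite.1 (h 0).1
    obtain ⟨M, hM⟩ := (hfin.image fun z => ‖z‖).bddAbove
    obtain ⟨m, hm⟩ := exists_nat_gt M
    obtain ⟨z, hz, hωz⟩ := Set.mem_iUnion₂.1 (h m).2
    have hz' : (m : ℝ) ≤ ‖z‖ := hz
    have hzC : z ∈ openCluster ω (0 : Site d) := hωz
    have hzM : ‖z‖ ≤ M := hM (Set.mem_image_of_mem _ hzC)
    linarith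
  have ht := tendsto_measure_iInter_atTop (μ := μ) (fun m => (hGm m).nullMeasurableSet) hanti
    ⟨0, measure_ne_top μ _⟩
  rw [hempty, measure_empty] at ht
  have ht' := (ENNReal.tendsto_toReal ENNReal.zero_ne_top).comp ht
  rw [ENNReal.toReal_zero] at ht'
  exact ht'

/-- Uniformly in the pair: for `ε > 0` there is `m` with `P_p(x ↔ y, |C(x)| < ∞) < ε` whenever
`‖x - y‖ ≥ m` (translate `x` to the origin). -/
private theorem exists_real_openConn_inter_compl_lt (p : unitInterval) {ε : ℝ} (hε : 0 < ε) :
    ∃ m : ℕ, ∀ x y : Site d, (m : ℝ) ≤ ‖x - y‖ →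
      (bondPercolation (zdGraph d) p).real (openConn x y ∩ (percolatesAt x)ᶜ) < ε := by
  have ht := tendsto_real_finiteCluster_reaches (d := d) p
  obtain ⟨m, hm⟩ := eventually_atTop.1 ((tendsto_order.1 ht).2 ε hε)
  refine ⟨m, fun x y hxy => lt_of_le_of_lt ?_ (hm m le_rfl)⟩
  rw [← preimage_shift_openConn_zero x y, ← preimage_shift_percolatesAt_zero x,
    ← Set.preimage_compl, ← Set.preimage_inter, bondPercolation_real_preimage_shift]
  refine measureReal_mono fun ω hω => ⟨hω.2, Set.mem_iUnion₂.2 ⟨y - x, ?_, hω.1⟩⟩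
  show (m : ℝ) ≤ ‖y - x‖
  rwa [norm_sub_rev]

/-- Along two sequences of sites drifting apart, `P_p(u n ↔ v n, |C(u n)| < ∞) → 0`. -/
private theorem tendsto_real_openConn_inter_compl (p : unitInterval) {u v : ℕ → Site d}
    (h : Tendsto (fun n => ‖u n - v n‖) atTop atTop) :
    Tendsto (fun n => (bondPercolation (zdGraph d) p).real
      (openConn (u n) (v n) ∩ (percolatesAt (u n))ᶜ)) atTop (𝓝 0) := by
  rw [Metric.tendsto_atTop]
  intro ε hε
  obtain ⟨m, hm⟩ := exists_real_openConn_inter_compl_lt (d := d) p hε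
  obtain ⟨N, hN⟩ := eventually_atTop.1 (tendsto_atTop.1 h m)
  refine ⟨N, fun n hn => ?_⟩
  rw [Real.dist_eq, sub_zero, abs_of_nonneg measureReal_nonneg]
  exact hm (u n) (v n) (hN n hn)

/-! ### `k`-fold mixing for the events `{|C(x_i)| = ∞}` -/

/-- **`k`-fold mixing of the product measure for `{|C(·)| = ∞}`**: if the pairwise distances of
`x n 1, …, x n k` tend to infinity then `P_p(⋂_i {|C(x n i)| = ∞}) → θ(p)^k`. -/
private theorem tendsto_real_iInter_percolatesAt (p : unitInterval) {k : ℕ}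
    (x : ℕ → Fin k → Site d)
    (hx : ∀ i j : Fin k, i ≠ j → Tendsto (fun n => ‖x n i - x n j‖) atTop atTop) :
    Tendsto (fun n => (bondPercolation (zdGraph d) p).real (⋂ i, percolatesAt (x n i))) atTop
      (𝓝 (theta (zdGraph d) (0 : Site d) p ^ k)) := by
  classical
  set μ := bondPercolation (zdGraph d) p with hμ
  have hθ : theta (zdGraph d) (0 : Site d) p = μ.real (percolatesAt 0) := rfl
  rw [Metric.tendsto_atTop]
  intro ε hε
  -- the error budget
  have hk0 : (0 : ℝ) < 2 * k + 1 := by positivity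
  set δ : ℝ := ε / (2 * k + 1) with hδ
  have hδpos : 0 < δ := div_pos hε hk0
  -- local approximation of `{|C(0)| = ∞}`
  have hP0m : MeasurableSet (percolatesAt (0 : Site d) : Set (BondConfig (Site d))) :=
    measurableSet_percolatesAt_holds 0
  obtain ⟨L, ⟨F, hLF⟩, hLP⟩ := exists_isLocalEvent_measure_symmDiff_lt (μ := μ) hP0m
    (ENNReal.ofReal_pos.2 hδpos)
  have hLm : MeasurableSet L := hLF.measurableSet_of_finset
  have hLPreal : μ.real (L ∆ percolatesAt 0) < δ := ENNReal.toReal_lt_of_lt_ofReal hLP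
  -- separation making the translates of `F` pairwise disjoint
  obtain ⟨R, hR⟩ := exists_radius F
  have hev : ∀ᶠ n in atTop, ∀ i j : Fin k, i ≠ j → 2 * R < ‖x n i - x n j‖ := by
    refine Filter.eventually_all.2 fun i => Filter.eventually_all.2 fun j => ?_
    by_cases hij : i = j
    · exact Filter.Eventually.of_forall fun n h => absurd hij h
    · exact ((hx i j hij).eventually (eventually_gt_atTop (2 * R))).mono fun n hn _ => hn
  obtain ⟨N, hN⟩ := eventually_atTop.1 hev
  refine ⟨N, fun n hn => ?_⟩
  -- the translated local events and their supports
  set T : Fin k → (BondConfig (Site d) ≃ᵐ BondConfig (Site d)) := fun i =>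
    BondConfig.relabel (sym2Equiv (Site.shift (-(x n i)))) with hT
  set S : Fin k → Set (Sym2 (Site d)) := fun i =>
    (sym2Equiv (Site.shift (-(x n i)))) ⁻¹' (↑F : Set (Sym2 (Site d))) with hS
  have hPT : ∀ i, (percolatesAt (x n i) : Set (BondConfig (Site d))) = T i ⁻¹' percolatesAt 0 :=
    fun i => (preimage_shift_percolatesAt_zero (x n i)).symm
  have hdet : ∀ i, DeterminedBy (T i ⁻¹' L) (S i) := fun i =>
    determinedBy_preimage_relabel_sym2 _ hLF
  have hPm : ∀ i, MeasurableSet (percolatesAt (x n i) : Set (BondConfig (Site d))) := fun i =>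
    measurableSet_percolatesAt_holds _
  have hL'm : ∀ i, MeasurableSet (T i ⁻¹' L) := fun i => (T i).measurable hLm
  have hdisj : Pairwise fun i j : Fin k => Disjoint (S i) (S j) := fun i j hij =>
    hR (x n i) (x n j) (hN n hn i j hij)
  -- (a) replacing `{|C(x n i)| = ∞}` by the translated local events
  have ha : |μ.real (⋂ i, percolatesAt (x n i)) - μ.real (⋂ i, T i ⁻¹' L)| ≤ k * δ := by
    calc |μ.real (⋂ i, percolatesAt (x n i)) - μ.real (⋂ i, T i ⁻¹' L)|
        ≤ μ.real ((⋂ i, percolatesAt (x n i)) ∆ (⋂ i, T i ⁻¹' L)) :=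
          abs_measureReal_sub_le_measureReal_symmDiff (MeasurableSet.iInter hPm).nullMeasurableSet
            (MeasurableSet.iInter hL'm).nullMeasurableSet
      _ ≤ μ.real (⋃ i, (percolatesAt (x n i)) ∆ (T i ⁻¹' L)) :=
          measureReal_mono (iInter_symmDiff_iInter_subset _ _)
      _ ≤ ∑ i, μ.real ((percolatesAt (x n i)) ∆ (T i ⁻¹' L)) := measureReal_iUnion_fintype_le _
      _ = ∑ _i : Fin k, μ.real (percolatesAt (0 : Site d) ∆ L) := by
          refine Finset.sum_congr rfl fun i _ => ?_
          rw [hPT i, ← Set.preimage_symmDiff]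
          exact bondPercolation_real_preimage_shift _ p _
      _ ≤ ∑ _i : Fin k, δ := Finset.sum_le_sum fun i _ => by
          rw [symmDiff_comm]; exact hLPreal.le
      _ = k * δ := by simp
  -- (b) independence of the translated local events
  have hb : μ.real (⋂ i, T i ⁻¹' L) = μ.real L ^ k := by
    have hprod : μ (⋂ i, T i ⁻¹' L) = ∏ i, μ (T i ⁻¹' L) :=
      (bondPercolation_iIndep_edgeSigma (zdGraph d) p S hdisj).meas_iInter
        fun i => (hdet i).measurableSet_edgeSigma (hL'm i)
    have hfac : ∀ i, (μ (T i ⁻¹' L)).toReal = μ.real L := fun i => by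
      rw [← measureReal_def]
      exact bondPercolation_real_preimage_shift _ p L
    rw [measureReal_def, hprod, ENNReal.toReal_prod]
    simp only [hfac, Finset.prod_const, Finset.card_univ, Fintype.card_fin]
  -- (c) replacing `μ(L)` by `θ`
  have hc : |μ.real L ^ k - theta (zdGraph d) (0 : Site d) p ^ k| ≤ k * δ := by
    have h1 : |μ.real L - theta (zdGraph d) (0 : Site d) p| ≤ δ := by
      rw [hθ]
      exact (abs_measureReal_sub_le_measureReal_symmDiff hLm.nullMeasurableSet
        hP0m.nullMeasurableSet).trans hLPreal.le
    calc |μ.real L ^ k - theta (zdGraph d) (0 : Site d) p ^ k|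
        ≤ k * |μ.real L - theta (zdGraph d) (0 : Site d) p| :=
          abs_pow_sub_pow_le_unit measureReal_nonneg measureReal_le_one
            (by rw [hθ]; exact measureReal_nonneg) (by rw [hθ]; exact measureReal_le_one) k
      _ ≤ k * δ := mul_le_mul_of_nonneg_left h1 (Nat.cast_nonneg k)
  -- conclusion
  rw [Real.dist_eq]
  calc |μ.real (⋂ i, percolatesAt (x n i)) - theta (zdGraph d) (0 : Site d) p ^ k|
      ≤ |μ.real (⋂ i, percolatesAt (x n i)) - μ.real (⋂ i, T i ⁻¹' L)| +
          |μ.real (⋂ i, T i ⁻¹' L) - theta (zdGraph d) (0 : Site d) p ^ k| := abs_sub_le _ _ _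
    _ ≤ k * δ + k * δ := add_le_add ha (by rw [hb]; exact hc)
    _ = δ * (2 * k + 1) - δ := by ring
    _ < δ * (2 * k + 1) := sub_lt_self _ hδpos
    _ = ε := div_mul_cancel₀ ε hk0.ne'

/-! ### The theorem -/

/-- **Jump ⟹ pattern-blindness** (route `PercTreeValue`, item `ConnectionPatternFactorisation`,
stmt-CriticalPhenomena-7802): on `ℤ³`, for every `p`, every `k`, every loopless pattern
`E ⊆ Fin k × Fin k` mentioning every index and every sequence `A n` of `k`-point configurations
with pairwise sup-distances tending to infinity,
`P_p(⋂_{(i,j) ∈ E} {A n i ↔ A n j}) → θ(p)^k`.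
Lower bound: `k`-fold mixing for `{|C(·)| = ∞}` and a.s. uniqueness of the infinite cluster;
upper bound: the same mixing plus `P_p(x ↔ y, |C(x)| < ∞) → 0` as `‖x - y‖ → ∞`. -/
theorem connectionPatternFactorisation_proof :
    Summit.CriticalPhenomena.PercolationContinuityZ3.Theses.PercTreeValue.ConnectionPatternFactorisation := by
  unfold Summit.CriticalPhenomena.PercolationContinuityZ3.Theses.PercTreeValue.ConnectionPatternFactorisation
  intro p k E hloop hcover A hA
  classical
  set μ := bondPercolation (zdGraph 3) p with hμ
  -- the main term and the error term
  set P : ℕ → ℝ := fun n => μ.real (⋂ i, percolatesAt (A n i)) with hP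
  set err : ℕ → ℝ := fun n =>
    ∑ e ∈ E, μ.real (openConn (A n e.1) (A n e.2) ∩ (percolatesAt (A n e.1))ᶜ) with herr
  have hPlim : Tendsto P atTop (𝓝 (theta (zdGraph 3) (0 : Site 3) p ^ k)) :=
    tendsto_real_iInter_percolatesAt p A hA
  have herrlim : Tendsto err atTop (𝓝 0) := by
    have h : Tendsto err atTop (𝓝 (∑ e ∈ E, (0 : ℝ))) := by
      refine tendsto_finsetSum E fun e he => ?_
      exact tendsto_real_openConn_inter_compl p (hA e.1 e.2 (hloop e he))
    rwa [Finset.sum_const_zero] at h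
  -- lower bound: uniqueness of the infinite cluster
  have hlow : ∀ n, P n ≤ μ.real (⋂ e ∈ E, openConn (A n e.1) (A n e.2)) := by
    intro n
    simp only [hP, measureReal_def]
    refine ENNReal.toReal_mono (measure_ne_top _ _) (measure_mono_ae ?_)
    filter_upwards [Grimmett1999_numInfiniteClusters_le_one_holds 3 p] with ω hω
    intro hωP
    refine Set.mem_iInter₂.2 fun e _ => ?_
    exact mem_openConn_of_numInfiniteClusters_le_one hω (Set.mem_iInter.1 hωP e.1)
      (Set.mem_iInter.1 hωP e.2)
  -- upper bound: a prescribed connection inside a finite cluster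
  have hup : ∀ n, μ.real (⋂ e ∈ E, openConn (A n e.1) (A n e.2)) ≤ P n + err n := by
    intro n
    have hsub : (⋂ e ∈ E, openConn (A n e.1) (A n e.2)) ⊆ (⋂ i, percolatesAt (A n i)) ∪
        ⋃ e ∈ E, (openConn (A n e.1) (A n e.2) ∩ (percolatesAt (A n e.1))ᶜ) := by
      intro ω hω
      by_cases hall : ∀ i, ω ∈ percolatesAt (A n i)
      · exact Or.inl (Set.mem_iInter.2 hall)
      · push Not at hall
        obtain ⟨i, hi⟩ := hall
        obtain ⟨e, he, hei⟩ := hcover i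
        have hωe : ω ∈ openConn (A n e.1) (A n e.2) := Set.mem_iInter₂.1 hω e he
        refine Or.inr (Set.mem_iUnion₂.2 ⟨e, he, hωe, ?_⟩)
        rcases hei with h1 | h2
        · rw [h1]; exact hi
        · intro h1
          have h2' := mem_percolatesAt_of_openConn hωe h1
          rw [h2] at h2'
          exact hi h2'
    calc μ.real (⋂ e ∈ E, openConn (A n e.1) (A n e.2))
        ≤ μ.real ((⋂ i, percolatesAt (A n i)) ∪
            ⋃ e ∈ E, (openConn (A n e.1) (A n e.2) ∩ (percolatesAt (A n e.1))ᶜ)) :=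
          measureReal_mono hsub
      _ ≤ μ.real (⋂ i, percolatesAt (A n i)) +
            μ.real (⋃ e ∈ E, (openConn (A n e.1) (A n e.2) ∩ (percolatesAt (A n e.1))ᶜ)) :=
          measureReal_union_le _ _
      _ ≤ P n + err n := add_le_add le_rfl (measureReal_biUnion_finset_le E _)
  -- squeeze
  have hlim2 : Tendsto (fun n => P n + err n) atTop (𝓝 (theta (zdGraph 3) (0 : Site 3) p ^ k)) := by
    have h := hPlim.add herrlim
    rwa [add_zero] at h
  exact tendsto_of_tendsto_of_tendsto_of_le_of_le hPlim hlim2 hlow hup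

end Summit.CriticalPhenomena.PercolationContinuityZ3.Theorems

end
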